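/-
Copyright (c) 2026. All rights reserved.
Released under Apache 2.0 license as described in the file LICENSE.
-/
import Mathlib
import Summits.MatrixMultiplication.MatrixMultiplication.Theorems.SubgroupIdentityDesigns.Negative.LevelOneNeumannSqueeze
import Summits.MatrixMultiplication.MatrixMultiplication.Theorems.SubgroupIdentityDesigns.Negative.LevelOneSmallPrimes
import Summits.MatrixMultiplication.MatrixMultiplication.Theorems.SubgroupIdentityDesigns.Negative.CellTwoOneEmpty

/-!
# The level-one slice of the crux is empty at every prime and dimension for `ε ≤ min(1, ε_N(p))`

Support file for the crux `LevelGradedCohnUmans.SubgroupIdentityDesigns` (the crux item stays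
open; this is a NEGATIVE structural result about its level-one slice `k = 1`).

Packaging of three verdicts, each uniform in the dimension:
`LevelOneSmallPrimes.no_crux_instance_le_seven` (`p ≤ 7`, every `m ≥ 2`, `0 < ε ≤ 1`),
`CellTwoOneEmpty.cellTwoOne_empty_all` (`m = 2`, every `p`, `0 < ε ≤ 1`) and the Neumann squeeze
`LevelOneNeumannSqueeze.no_levelOne_witness_neumann_eps` (`p ≥ 11`, every `m ≥ 3`,
`p^{ε/2} ≤ (5/2)^{(2+ε)/3}`):

* `no_crux_instance_threshold` : for EVERY prime `p` and every `0 < ε ≤ 1` with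
  **`p^{ε/2} ≤ (5/2)^{(2+ε)/3}`** (i.e. `ε ≤ ε_N(p) = 2 log(5/2)/((3/2) log p − log(5/2))
  ≈ 1.2217/(log p − 0.6109)`), NO subgroup triple of ANY `GL_m(𝔽_p)`, `m ≥ 2`, satisfies the
  subgroup TPP, carries a level-one identity design and satisfies the crux inequality at `ε`
  (crux clause verbatim, `k = 1`);
* `thr_of_cube_le` : the threshold holds for every `ε ≤ 1/q` as soon as `p³ ≤ (5/2)^{4q+2}`
  (`q ≥ 1`; the log form `(ε/2) log p ≤ ((2+ε)/3) log(5/2)` is linear in `ε` with slope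
  `(1/2) log p − (1/3) log(5/2) ≥ 0`), whence `thr_half` (`p ≤ 19`, `ε ≤ 1/2`:
  `19³ = 6859 ≤ (5/2)^{10}`) and `thr_quarter` (`p ≤ 241`, `ε ≤ 1/4`: `241³ ≤ (5/2)^{18}`);
* `no_crux_instance_half` : **for every prime `p ≤ 19` and every `0 < ε ≤ 1/2`, the level-one
  slice of the crux is empty in every dimension `m ≥ 2`**;
* `no_crux_instance_quarter` : **the same for every prime `p ≤ 241` and every `0 < ε ≤ 1/4`**.

(Before this series the level-one slice was closed in every dimension only for
`ε ≤ ε₃(p) = 2 log 2/(3 log p − log 2)`, `LevelOneDimSqueeze`: `ε₃(5) ≈ 0.33`, `ε₃(19) ≈ 0.17`,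
`ε₃(241) ≈ 0.088`.)  What remains open at level one: `p ≥ 11` with `ε_N(p) < ε < 2`, and every
`p` with `1 < ε < 2` except `p = 2` (`PTwoAllDimensions`, all `ε`).

Honest framing: VALUE = THEOREM, NOT summit progress.  Sorry-free; standard axioms; no new
definitions.  Report: `run/shared/lean/b2b/levelgraded-cu/ORACLE-g19.md` §G19-4.
-/

set_option linter.dupNamespace false

noncomputable section

open scoped BigOperators Classical Matrix

namespace Summit.MatrixMultiplication.MatrixMultiplication.Theorems.SubgroupIdentityDesigns.Negative
namespace LevelOneUniform

open Literature.Barriers.MatrixMultiplication (SubgroupTPP)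
open Summit.MatrixMultiplication.MatrixMultiplication.Theorems.LieRankDesigns.Negative
  (GLm Mat budget)
open LevelOneNeumannSqueeze (no_levelOne_witness_neumann_eps)
open LevelOneSmallPrimes (no_crux_instance_le_seven)

variable {p : ℕ} [hp : Fact p.Prime]

/-! ## The threshold in closed form -/

omit hp in
/-- Log form of the threshold. -/
theorem thr_of_log (hp0 : (0 : ℝ) < p) {ε : ℝ}
    (h : ε / 2 * Real.log p ≤ (2 + ε) / 3 * Real.log (5 / 2)) :
    (p : ℝ) ^ (ε / 2) ≤ (5 / 2 : ℝ) ^ ((2 + ε) / 3) := by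
  rw [Real.rpow_def_of_pos hp0, Real.rpow_def_of_pos (by norm_num)]
  exact Real.exp_le_exp.mpr (by linarith)

omit hp in
/-- **THE THRESHOLD FROM ONE INTEGER INEQUALITY.**  If `p³ ≤ (5/2)^{4q+2}` (`q ≥ 1`) then
`p^{ε/2} ≤ (5/2)^{(2+ε)/3}` for every `ε ≤ 1/q` (the log form is linear in `ε` with
non-negative slope `(1/2) log p − (1/3) log(5/2)` as soon as `p³ ≥ (5/2)²`). -/
theorem thr_of_cube_le (hp2 : 2 ≤ p) {q : ℕ} (hq : 1 ≤ q)
    (hcube : (p : ℝ) ^ 3 ≤ (5 / 2 : ℝ) ^ (4 * q + 2)) {ε : ℝ}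
    (hεq : ε ≤ 1 / q) : (p : ℝ) ^ (ε / 2) ≤ (5 / 2 : ℝ) ^ ((2 + ε) / 3) := by
  have hpR : (2 : ℝ) ≤ p := by exact_mod_cast hp2
  have hp0 : (0 : ℝ) < p := by linarith
  have hqR : (1 : ℝ) ≤ q := by exact_mod_cast hq
  have hq0 : (0 : ℝ) < q := by linarith
  refine thr_of_log hp0 ?_
  set A : ℝ := Real.log p with hA_def
  set B : ℝ := Real.log (5 / 2) with hB_def
  have hB0 : 0 < B := Real.log_pos (by norm_num)
  -- slope ≥ 0 : `2 B ≤ 3 A` from `(5/2)² ≤ 8 ≤ p³`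
  have hslope : 2 * B ≤ 3 * A := by
    have h8 : (2 : ℝ) ^ 3 ≤ (p : ℝ) ^ 3 := pow_le_pow_left₀ (by norm_num) hpR 3
    have h1 : Real.log ((5 / 2 : ℝ) ^ 2) ≤ Real.log ((p : ℝ) ^ 3) :=
      Real.log_le_log (by norm_num) (le_trans (by norm_num) h8)
    rw [Real.log_pow, Real.log_pow] at h1
    push_cast at h1
    linarith
  -- value at `ε = 1/q` : `3 A ≤ (4q + 2) B`
  have hend : 3 * A ≤ (4 * q + 2) * B := by
    have h1 : Real.log ((p : ℝ) ^ 3) ≤ Real.log ((5 / 2 : ℝ) ^ (4 * q + 2)) :=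
      Real.log_le_log (by positivity) hcube
    rw [Real.log_pow, Real.log_pow] at h1
    push_cast at h1
    linarith
  have h1 : ε * (3 * A - 2 * B) ≤ 1 / q * (3 * A - 2 * B) :=
    mul_le_mul_of_nonneg_right hεq (by linarith)
  have h2 : 1 / (q : ℝ) * (3 * A - 2 * B) ≤ 4 * B := by
    rw [one_div, inv_mul_le_iff₀ hq0]
    nlinarith
  nlinarith

omit hp in
/-- `ε ≤ 1/2` and `p ≤ 19` give the threshold (`19³ = 6859 ≤ (5/2)^{10} ≈ 9537`). -/
theorem thr_half (hp2 : 2 ≤ p) (hp19 : p ≤ 19) {ε : ℝ} (hε2 : ε ≤ 1 / 2) :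
    (p : ℝ) ^ (ε / 2) ≤ (5 / 2 : ℝ) ^ ((2 + ε) / 3) := by
  have hpR : (p : ℝ) ≤ 19 := by exact_mod_cast hp19
  have hp0 : (0 : ℝ) ≤ p := Nat.cast_nonneg _
  refine thr_of_cube_le hp2 (q := 2) (by norm_num) ?_ (by simpa using hε2)
  calc (p : ℝ) ^ 3 ≤ 19 ^ 3 := pow_le_pow_left₀ hp0 hpR 3
    _ ≤ (5 / 2 : ℝ) ^ (4 * 2 + 2) := by norm_num

omit hp in
/-- `ε ≤ 1/4` and `p ≤ 241` give the threshold
(`241³ = 13 997 521 ≤ (5/2)^{18} ≈ 14 551 915`). -/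
theorem thr_quarter (hp2 : 2 ≤ p) (hp241 : p ≤ 241) {ε : ℝ} (hε4 : ε ≤ 1 / 4) :
    (p : ℝ) ^ (ε / 2) ≤ (5 / 2 : ℝ) ^ ((2 + ε) / 3) := by
  have hpR : (p : ℝ) ≤ 241 := by exact_mod_cast hp241
  have hp0 : (0 : ℝ) ≤ p := Nat.cast_nonneg _
  refine thr_of_cube_le hp2 (q := 4) (by norm_num) ?_ (by simpa using hε4)
  calc (p : ℝ) ^ 3 ≤ 241 ^ 3 := pow_le_pow_left₀ hp0 hpR 3
    _ ≤ (5 / 2 : ℝ) ^ (4 * 4 + 2) := by norm_num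

/-! ## Packaging over all primes and dimensions -/

/-- **NO LEVEL-ONE CRUX INSTANCE AT ANY PRIME, ANY DIMENSION `m ≥ 2`, UNDER THE THRESHOLD.**
For every prime `p` and `0 < ε ≤ 1` with `p^{ε/2} ≤ (5/2)^{(2+ε)/3}`: no subgroup triple of any
`GL_m(𝔽_p)`, `m ≥ 2`, satisfies the subgroup TPP, carries a level-one identity design, and
satisfies the crux inequality at `ε` (crux clause verbatim, `k = 1`). -/
theorem no_crux_instance_threshold {ε : ℝ} (hε : 0 < ε) (hε1 : ε ≤ 1)
    (hthr : (p : ℝ) ^ (ε / 2) ≤ (5 / 2 : ℝ) ^ ((2 + ε) / 3)) :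
    ¬ ∃ (m : ℕ) (_ : 2 ≤ m)
      (H₁ H₂ H₃ : Subgroup (Matrix.GeneralLinearGroup (Fin m) (ZMod p))),
      Literature.Barriers.MatrixMultiplication.SubgroupTPP H₁ H₂ H₃ ∧
      (∃ c : Matrix (Fin m) (Fin m) (ZMod p) → ℂ, (∀ M, 1 < M.rank → c M = 0) ∧
        (∑ M : Matrix (Fin m) (Fin m) (ZMod p), c M * ZMod.stdAddChar
          (Matrix.trace (M * ((1 : Matrix.GeneralLinearGroup (Fin m) (ZMod p)) :
            Matrix (Fin m) (Fin m) (ZMod p))))) = 1 ∧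
        ∀ a ∈ H₁, ∀ b ∈ H₂, ∀ g ∈ H₃, a * b * g ≠ 1 →
          (∑ M : Matrix (Fin m) (Fin m) (ZMod p), c M * ZMod.stdAddChar
            (Matrix.trace (M * ((a * b * g : Matrix.GeneralLinearGroup (Fin m) (ZMod p)) :
              Matrix (Fin m) (Fin m) (ZMod p))))) = 0) ∧
      (∑ᶠ χ ∈ Literature.RepresentationTheory.FiniteGroups.irrChars
          (Matrix.GeneralLinearGroup (Fin m) (ZMod p)) ∩
          {f | ∃ c : Matrix (Fin m) (Fin m) (ZMod p) → ℂ, (∀ M, 1 < M.rank → c M = 0) ∧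
            ∀ g : Matrix.GeneralLinearGroup (Fin m) (ZMod p), f g =
              ∑ M : Matrix (Fin m) (Fin m) (ZMod p), c M * ZMod.stdAddChar
                (Matrix.trace (M * (g : Matrix (Fin m) (Fin m) (ZMod p))))},
        (χ 1).re ^ (2 + ε)) <
        ((Nat.card H₁ * Nat.card H₂ * Nat.card H₃ : ℕ) : ℝ) ^ ((2 + ε) / 3) := by
  rintro ⟨m, hm, H₁, H₂, H₃, htpp, hdes, hlt⟩
  rcases le_or_gt p 7 with hp7 | hp8
  · exact no_crux_instance_le_seven hp7 hε hε1 ⟨m, hm, H₁, H₂, H₃, htpp, hdes, hlt⟩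
  · have hp11 : 11 ≤ p := by
      have hpr := hp.out
      rcases lt_or_ge p 11 with h | h
      · interval_cases p <;> exact absurd hpr (by norm_num)
      · exact h
    obtain rfl | hm3 := eq_or_lt_of_le hm
    · exact cellTwoOne_empty_all hε hε1 htpp hdes hlt
    · obtain ⟨l, rfl⟩ : ∃ l, m = 1 + l := ⟨m - 1, by omega⟩
      exact no_levelOne_witness_neumann_eps (by omega) hp11 (Or.inr (by omega)) hε hthr htpp
        hdes hlt

/-- **EVERY PRIME `p ≤ 19`, EVERY `0 < ε ≤ 1/2`, EVERY DIMENSION `m ≥ 2`: the level-one slice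
of the crux is empty.** -/
theorem no_crux_instance_half (hp19 : p ≤ 19) {ε : ℝ} (hε : 0 < ε) (hε2 : ε ≤ 1 / 2) :
    ¬ ∃ (m : ℕ) (_ : 2 ≤ m)
      (H₁ H₂ H₃ : Subgroup (Matrix.GeneralLinearGroup (Fin m) (ZMod p))),
      Literature.Barriers.MatrixMultiplication.SubgroupTPP H₁ H₂ H₃ ∧
      (∃ c : Matrix (Fin m) (Fin m) (ZMod p) → ℂ, (∀ M, 1 < M.rank → c M = 0) ∧
        (∑ M : Matrix (Fin m) (Fin m) (ZMod p), c M * ZMod.stdAddChar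
          (Matrix.trace (M * ((1 : Matrix.GeneralLinearGroup (Fin m) (ZMod p)) :
            Matrix (Fin m) (Fin m) (ZMod p))))) = 1 ∧
        ∀ a ∈ H₁, ∀ b ∈ H₂, ∀ g ∈ H₃, a * b * g ≠ 1 →
          (∑ M : Matrix (Fin m) (Fin m) (ZMod p), c M * ZMod.stdAddChar
            (Matrix.trace (M * ((a * b * g : Matrix.GeneralLinearGroup (Fin m) (ZMod p)) :
              Matrix (Fin m) (Fin m) (ZMod p))))) = 0) ∧
      (∑ᶠ χ ∈ Literature.RepresentationTheory.FiniteGroups.irrChars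
          (Matrix.GeneralLinearGroup (Fin m) (ZMod p)) ∩
          {f | ∃ c : Matrix (Fin m) (Fin m) (ZMod p) → ℂ, (∀ M, 1 < M.rank → c M = 0) ∧
            ∀ g : Matrix.GeneralLinearGroup (Fin m) (ZMod p), f g =
              ∑ M : Matrix (Fin m) (Fin m) (ZMod p), c M * ZMod.stdAddChar
                (Matrix.trace (M * (g : Matrix (Fin m) (Fin m) (ZMod p))))},
        (χ 1).re ^ (2 + ε)) <
        ((Nat.card H₁ * Nat.card H₂ * Nat.card H₃ : ℕ) : ℝ) ^ ((2 + ε) / 3) :=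
  no_crux_instance_threshold hε (by linarith) (thr_half hp.out.two_le hp19 hε2)

/-- **EVERY PRIME `p ≤ 241`, EVERY `0 < ε ≤ 1/4`, EVERY DIMENSION `m ≥ 2`: the level-one slice
of the crux is empty.** -/
theorem no_crux_instance_quarter (hp241 : p ≤ 241) {ε : ℝ} (hε : 0 < ε) (hε4 : ε ≤ 1 / 4) :
    ¬ ∃ (m : ℕ) (_ : 2 ≤ m)
      (H₁ H₂ H₃ : Subgroup (Matrix.GeneralLinearGroup (Fin m) (ZMod p))),
      Literature.Barriers.MatrixMultiplication.SubgroupTPP H₁ H₂ H₃ ∧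
      (∃ c : Matrix (Fin m) (Fin m) (ZMod p) → ℂ, (∀ M, 1 < M.rank → c M = 0) ∧
        (∑ M : Matrix (Fin m) (Fin m) (ZMod p), c M * ZMod.stdAddChar
          (Matrix.trace (M * ((1 : Matrix.GeneralLinearGroup (Fin m) (ZMod p)) :
            Matrix (Fin m) (Fin m) (ZMod p))))) = 1 ∧
        ∀ a ∈ H₁, ∀ b ∈ H₂, ∀ g ∈ H₃, a * b * g ≠ 1 →
          (∑ M : Matrix (Fin m) (Fin m) (ZMod p), c M * ZMod.stdAddChar
            (Matrix.trace (M * ((a * b * g : Matrix.GeneralLinearGroup (Fin m) (ZMod p)) :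
              Matrix (Fin m) (Fin m) (ZMod p))))) = 0) ∧
      (∑ᶠ χ ∈ Literature.RepresentationTheory.FiniteGroups.irrChars
          (Matrix.GeneralLinearGroup (Fin m) (ZMod p)) ∩
          {f | ∃ c : Matrix (Fin m) (Fin m) (ZMod p) → ℂ, (∀ M, 1 < M.rank → c M = 0) ∧
            ∀ g : Matrix.GeneralLinearGroup (Fin m) (ZMod p), f g =
              ∑ M : Matrix (Fin m) (Fin m) (ZMod p), c M * ZMod.stdAddChar
                (Matrix.trace (M * (g : Matrix (Fin m) (Fin m) (ZMod p))))},
        (χ 1).re ^ (2 + ε)) <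
        ((Nat.card H₁ * Nat.card H₂ * Nat.card H₃ : ℕ) : ℝ) ^ ((2 + ε) / 3) :=
  no_crux_instance_threshold hε (by linarith) (thr_quarter hp.out.two_le hp241 hε4)

end LevelOneUniform
end Summit.MatrixMultiplication.MatrixMultiplication.Theorems.SubgroupIdentityDesigns.Negative
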